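import Summits.MatrixMultiplication.OmegaCensus.ThreeSetLineModFourSlice
import HarnessLib

/-!
# The bit-sliced MOD-4 FILTER, VIII: tail blocks (definitions)

ω-census `pub-omega`, family (b3), seat pub-omega-group gen 42.  Framing: lottery ticket; floor = certified bounds/negative
ranges.  VALUE: a kernel TOOL for the three-set cube cells `(4, d, e)@p²` (`ThreeSetZpCells4Core`); NOT progress on ω.
A TAIL block is the part of a block `(compsLit n j).map (pre ++ ·)` whose first free entry is `≥ c₀`; it equals
`{pre ++ bumpHead c₀ l : l ∈ compsLit n (j − c₀)}` and is evaluated in ONE sliced pass: the planes of `compsLit n (j − c₀)` with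
the digit of coordinate `|pre|` bumped by `c₀` (`bumpDigits`, `blockChkT`).  This lets the block tree peel only the big leading
children of a node and keep the remainder as one block (the sliced filter costs ≈ 10⁵ operations per block whatever its size,
so few big blocks are what matters).  Soundness and the split lemma: `ThreeSetLineModFourSliceTailSound`.
-/

namespace Summit.MatrixMultiplication.OmegaCensus

/-! # Tail blocks: the data of a `compsLit` block whose first free entry is `≥ c₀`, as ONE sliced block -/

namespace LineMod

/-- The constant sliced digit `c` (mod 4) on all data below `L` (`ones = 2^L − 1`). [folklore] -/
def cst2 (ones c : ℕ) : S2 := (if c % 2 = 1 then ones else 0, if c / 2 % 2 = 1 then ones else 0)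

/-- Add the constant `c₀` to digit `i₀` of the sliced data. [folklore] -/
def bumpDigits (p ones i₀ c₀ : ℕ) (X : List S2) : List S2 :=
  (List.range p).map fun i => if i = i₀ then add2 (vget X i) (cst2 ones c₀) else vget X i

/-- Add `c₀` to the head of a list. [folklore] -/
def bumpHead (c₀ : ℕ) : List ℕ → List ℕ
  | [] => []
  | a :: t => (a + c₀) :: t

/-- **The tail-block checker**: the data `pre ++ bumpHead c₀ l`, `l ∈ compsLit n j` — i.e. the members of the block
`(compsLit n (j + c₀)).map (pre ++ ·)` whose first free entry is `≥ c₀` — in ONE sliced evaluation (planes of `compsLit n j`,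
digit `|pre|` bumped by `c₀`).  Lets the block tree peel the big leading child(ren) and keep the whole remainder as one block.
[folklore] -/
def blockChkT (p K d e : ℕ) (W pre : List ℕ) (n j c₀ : ℕ) (sched : List Bool) : Bool :=
  let B := blockPlanes pre n j
  let ones := onesOf B.1
  (0 < p : Bool) && (3 * p < 256 : Bool) && (W.length == p) && (pre.length + n == p) && (0 < n : Bool) &&
  (pre.sum + c₀ + j == d) && (0 < W.sum * d : Bool) && (3 * (W.sum * d) * e + 1 == p * K) &&
  (survMask p ones K e W (bumpDigits p ones pre.length c₀ (sdigits p B.2)) sched == 0)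

end LineMod

end Summit.MatrixMultiplication.OmegaCensus
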